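import Literature.Probability.LatticeModels.HoleFreePotential
import Literature.Probability.LatticeModels.DomainDiscretisation
import Literature.Probability.RandomPlanarGeometry.JordanDomainProofs
import HarnessLib

/-!
# Escape lemma for the inner lattice approximant of a Jordan domain
— helper of stub `stub_greenConvergence` (GC) of line `symplectic-fermion-anchor`
(crux `SAWLoopFugacityFlow.AvoidanceLimit`, stmt-CriticalPhenomena-10649; lead c2 GC-sandwich
programme, brick W-C1)

**What.** Fix a Jordan domain `D'`, a mesh `δ > 0`, and call a site `w ∈ ℤ²` *good* when the closed
`2δ`-ball around its mesh point `δw` lies in `D'`. `escape_of_not_closedBall_subset` (registered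
signature): a site `x` that is not good can be joined, by nearest-neighbour steps of `ℤ²` between
non-good sites (`FaceStep`), to sites of arbitrarily large second coordinate. This is the escape
clause of `HoleFree` (`Literature/Probability/LatticeModels/HoleFreePotential`) for the inner
approximant of `D'`.

**Proof.** A site whose mesh point is within `2δ` of a point `p ∉ D'` is not good. *Two-leg
descent* (`reflTransGen_faceStep_nearestSite`): such a site `w` is joined to `nearestSite δ p`
through non-good sites — walk vertically to the row `round (p.im/δ)`, then horizontally; an integer
between an integer `u` and `round b` is at least as close to `b` as `u` (`round_le`), so along both
legs neither coordinate gap to `p` increases, the distance to `p` stays `≤ 2δ`, and every site met is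
non-good. *Chain in the complement*: `ℂ \ D'` is preconnected
(`JordanDomain.isPreconnected_compl`) and, `D'` being bounded, contains a point `q_far` high up; by
`IsPreconnected.induction₂'` the relation "`nearestSite δ a` is joined to `nearestSite δ b`" holds
for all `a, b ∈ ℂ \ D'`, because for `dist a b < δ` the site `nearestSite δ a` is within `2δ` of `b`
and two-leg descent applies. Concatenate: `x → nearestSite δ q → nearestSite δ q_far`, where
`q ∉ D'` is the witness of non-goodness of `x`.

Sources: folklore lattice geometry; no definitions; nothing from the literature is asserted here.
-/

noncomputable section

open scoped BigOperators Topology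
open Filter Finset
open Literature.Probability.RandomPlanarGeometry Literature.Probability.LatticeModels

namespace Summit.CriticalPhenomena.SAWScalingLimit.Theorems.AvoidanceLimit.Anchor

/-! ## Walking along a coordinate axis -/

/-- Walking along the coordinate axis `i` from `w` to `w + k eᵢ` by face steps avoiding `P`,
given that every site of the closed lattice segment is outside `P`. [folklore] -/
theorem reflTransGen_faceStep_add_single (P : Set (Site 2)) (w : Site 2) (i : Fin 2) (k : ℤ) :
    (∀ j : ℤ, (0 ≤ j ∧ j ≤ k) ∨ (k ≤ j ∧ j ≤ 0) → w + Pi.single i j ∉ P) →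
      Relation.ReflTransGen (FaceStep P) w (w + Pi.single i k) := by
  induction k using Int.induction_on with
  | zero =>
    intro _
    rw [Pi.single_zero, add_zero]
  | succ n ih =>
    intro h
    refine (ih fun j hj => h j (by omega)).tail ⟨?_, h n (by omega), h (n + 1) (by omega)⟩
    rw [zdGraph_adj_iff]
    exact ⟨i, Or.inl (by rw [add_assoc, ← Pi.single_add])⟩
  | pred n ih =>
    intro h
    refine (ih fun j hj => h j (by omega)).tail ⟨?_, h (-n) (by omega), h (-n - 1) (by omega)⟩
    rw [zdGraph_adj_iff]
    refine ⟨i, Or.inr ?_⟩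
    rw [add_assoc, ← Pi.single_add]
    congr 2
    ring

/-! ## Rounding domination and the two-leg descent -/

/-- An integer `t` between an integer `u` and `round b` is at least as close to `b` as `u`
(`round_le`: `round b` is a nearest integer). [folklore] -/
theorem abs_sub_le_of_between_round (b : ℝ) (u t : ℤ)
    (ht : (u ≤ t ∧ t ≤ round b) ∨ (round b ≤ t ∧ t ≤ u)) : |b - t| ≤ |b - u| := by
  have hr : |b - round b| ≤ |b - u| := round_le b u
  rw [abs_le]
  rcases ht with ⟨h1, h2⟩ | ⟨h1, h2⟩
  · have h1' : (u : ℝ) ≤ t := Int.cast_le.2 h1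
    have h2' : (t : ℝ) ≤ round b := Int.cast_le.2 h2
    have := neg_abs_le (b - round b)
    have := le_abs_self (b - u)
    constructor <;> linarith
  · have h1' : ((round b : ℤ) : ℝ) ≤ t := Int.cast_le.2 h1
    have h2' : (t : ℝ) ≤ u := Int.cast_le.2 h2
    have := neg_abs_le (b - u)
    have := le_abs_self (b - round b)
    constructor <;> linarith

/-- A site whose mesh point is within `2δ` of a point outside `Ω` is not a vertex of the inner
approximant `{w | closedBall (δw) (2δ) ⊆ Ω}`. [folklore] -/
theorem not_mem_inner_of_dist_le {Ω : Set ℂ} {δ : ℝ} {p : ℂ} (hp : p ∉ Ω) {v : Site 2}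
    (hv : dist (meshPoint δ v) p ≤ 2 * δ) :
    v ∉ {w : Site 2 | Metric.closedBall (meshPoint δ w) (2 * δ) ⊆ Ω} :=
  fun h => hp (h (Metric.mem_closedBall.2 (by rwa [dist_comm])))

/-- Coordinatewise domination of the gaps to `p` gives domination of the distance to `p`.
[folklore] -/
theorem dist_meshPoint_le_of_abs_le {δ : ℝ} {p : ℂ} {v w : Site 2}
    (h0 : |p.re - δ * v 0| ≤ |p.re - δ * w 0|) (h1 : |p.im - δ * v 1| ≤ |p.im - δ * w 1|) :
    dist (meshPoint δ v) p ≤ dist (meshPoint δ w) p := by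
  rw [Complex.dist_eq, Complex.dist_eq, ← sq_le_sq₀ (norm_nonneg _) (norm_nonneg _),
    Complex.sq_norm, Complex.sq_norm, Complex.normSq_apply, Complex.normSq_apply]
  have h0' := sq_le_sq.2 h0
  have h1' := sq_le_sq.2 h1
  simp only [Complex.sub_re, Complex.sub_im, meshPoint_re, meshPoint_im]
  nlinarith [h0', h1']

/-- **Two-leg descent.** If `p ∉ Ω` and the mesh point of `w` is within `2δ` of `p`, then `w` is
joined to `nearestSite δ p` by face steps between sites outside the inner approximant: first the
vertical leg to the row `round (p.im/δ)`, then the horizontal leg to the column `round (p.re/δ)`;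
along both legs the coordinate gaps to `p` do not increase (`abs_sub_le_of_between_round`), so
every site met is within `2δ` of `p`. [folklore] -/
theorem reflTransGen_faceStep_nearestSite {Ω : Set ℂ} {δ : ℝ} (hδ : 0 < δ) {p : ℂ} (hp : p ∉ Ω)
    (w : Site 2) (hw : dist (meshPoint δ w) p ≤ 2 * δ) :
    Relation.ReflTransGen (FaceStep {v : Site 2 | Metric.closedBall (meshPoint δ v) (2 * δ) ⊆ Ω})
      w (nearestSite δ p) := by
  -- scaled rounding domination
  have key : ∀ (c : ℝ) (u t : ℤ), (u ≤ t ∧ t ≤ round (c / δ)) ∨ (round (c / δ) ≤ t ∧ t ≤ u) →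
      |c - δ * t| ≤ |c - δ * u| := by
    intro c u t ht
    have h := abs_sub_le_of_between_round (c / δ) u t ht
    have e : ∀ z : ℤ, c - δ * z = δ * (c / δ - z) := fun z => by
      rw [mul_sub, mul_div_cancel₀ _ hδ.ne']
    rw [e, e, abs_mul, abs_mul, abs_of_pos hδ]
    exact mul_le_mul_of_nonneg_left h hδ.le
  have k0 := key p.re
  have k1 := key p.im
  have hn : nearestSite δ p = ![round (p.re / δ), round (p.im / δ)] := rfl
  rw [hn]
  clear key hn
  generalize round (p.re / δ) = A at k0 ⊢
  generalize round (p.im / δ) = B at k1 ⊢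
  -- leg 1: vertical, from `w` to `w + (B - w 1) e₁`
  have leg1 : Relation.ReflTransGen
      (FaceStep {v : Site 2 | Metric.closedBall (meshPoint δ v) (2 * δ) ⊆ Ω})
      w (w + Pi.single 1 (B - w 1)) := by
    refine reflTransGen_faceStep_add_single _ w 1 (B - w 1) fun j hj => ?_
    refine not_mem_inner_of_dist_le hp ((dist_meshPoint_le_of_abs_le ?_ ?_).trans hw)
    · have : (w + Pi.single (1 : Fin 2) j : Site 2) 0 = w 0 := by simp
      rw [this]
    · have : (w + Pi.single (1 : Fin 2) j : Site 2) 1 = w 1 + j := by simp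
      rw [this]
      exact k1 (w 1) (w 1 + j) (by omega)
  -- leg 2: horizontal, from `w' := w + (B - w 1) e₁` to `w' + (A - w 0) e₀ = (A, B)`
  have h0 : (w + Pi.single (1 : Fin 2) (B - w 1) : Site 2) 0 = w 0 := by simp
  have h1 : (w + Pi.single (1 : Fin 2) (B - w 1) : Site 2) 1 = B := by simp
  generalize w + Pi.single (1 : Fin 2) (B - w 1) = w' at leg1 h0 h1
  have leg2 : Relation.ReflTransGen
      (FaceStep {v : Site 2 | Metric.closedBall (meshPoint δ v) (2 * δ) ⊆ Ω})
      w' (w' + Pi.single 0 (A - w 0)) := by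
    refine reflTransGen_faceStep_add_single _ w' 0 (A - w 0) fun j hj => ?_
    refine not_mem_inner_of_dist_le hp ((dist_meshPoint_le_of_abs_le ?_ ?_).trans hw)
    · have : (w' + Pi.single (0 : Fin 2) j : Site 2) 0 = w 0 + j := by simp [h0]
      rw [this]
      exact k0 (w 0) (w 0 + j) (by omega)
    · have : (w' + Pi.single (0 : Fin 2) j : Site 2) 1 = B := by simp [h1]
      rw [this]
      exact k1 (w 1) B (by omega)
  have hend : w' + Pi.single (0 : Fin 2) (A - w 0) = ![A, B] := by
    ext i
    fin_cases i
    · simp [h0]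
    · simp [h1]
  exact hend ▸ leg1.trans leg2

/-! ## The escape lemma -/

/-- **Escape lemma for the inner approximant** (registered signature, GC-sandwich brick W-C1).
If the closed `2δ`-ball around `δx` is not inside the Jordan domain `D'`, then `x` is joined, by
nearest-neighbour steps between sites with the same defect, to sites of arbitrarily large second
coordinate. Proof: the witness `q ∉ D'` of the defect and a point `q_far ∉ D'` high above the bounded
set `D'` are joined inside the preconnected set `ℂ \ D'` (`JordanDomain.isPreconnected_compl`) in
the sense of `IsPreconnected.induction₂'` for the transitive relation "the nearest sites are joined",
which holds locally by two-leg descent (`reflTransGen_faceStep_nearestSite`); and `x` is joined to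
`nearestSite δ q` by two-leg descent as well. [folklore] -/
theorem escape_of_not_closedBall_subset :
    ∀ (D' : JordanDomain) (δ : ℝ), 0 < δ → ∀ (x : Site 2),
      ¬ (Metric.closedBall (meshPoint δ x) (2 * δ) ⊆ D'.carrier) → ∀ M : ℤ, ∃ g' : Site 2, M ≤ g' 1 ∧
        Relation.ReflTransGen (FaceStep {w : Site 2 | Metric.closedBall (meshPoint δ w) (2 * δ) ⊆ D'.carrier}) x g' := by
  intro D' δ hδ x hx M
  obtain ⟨q, hqx, hqD⟩ := Set.not_subset.1 hx
  rw [Metric.mem_closedBall, dist_comm] at hqx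
  -- a point of the complement high above `D'`
  obtain ⟨r, hr⟩ := (Metric.isBounded_iff_subset_closedBall (0 : ℂ)).1 D'.isBounded
  obtain ⟨R, hR⟩ : ∃ R : ℝ, R = |r| + 1 + δ * |(M : ℝ)| := ⟨_, rfl⟩
  have hR0 : 0 ≤ R := by rw [hR]; positivity
  have hqfD : (⟨0, R⟩ : ℂ) ∉ D'.carrier := by
    intro h
    have h1 := hr h
    rw [Metric.mem_closedBall, dist_zero_right] at h1
    have h2 : |(⟨0, R⟩ : ℂ).im| ≤ ‖(⟨0, R⟩ : ℂ)‖ := Complex.abs_im_le_norm _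
    have h3 : |(⟨0, R⟩ : ℂ).im| = R := by simp [abs_of_nonneg hR0]
    have h4 := le_abs_self r
    have h5 : 0 ≤ δ * |(M : ℝ)| := by positivity
    linarith
  have hM : M ≤ nearestSite δ ⟨0, R⟩ 1 := by
    have h3 : nearestSite δ ⟨0, R⟩ 1 = round (R / δ) := by simp [nearestSite]
    rw [h3, round_eq, Int.le_floor]
    have h4 : (M : ℝ) ≤ R / δ := by
      rw [le_div_iff₀ hδ]
      have h5 : δ * (M : ℝ) ≤ δ * |(M : ℝ)| := mul_le_mul_of_nonneg_left (le_abs_self _) hδ.le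
      have h6 := abs_nonneg r
      linarith [mul_comm (M : ℝ) δ]
    linarith
  -- chain in the complement: the nearest sites of any two points of `ℂ \ D'` are joined
  have hchain : ∀ {a b : ℂ}, a ∈ D'.carrierᶜ → b ∈ D'.carrierᶜ →
      Relation.ReflTransGen
        (FaceStep {w : Site 2 | Metric.closedBall (meshPoint δ w) (2 * δ) ⊆ D'.carrier})
        (nearestSite δ a) (nearestSite δ b) := by
    intro a b ha hb
    refine D'.isPreconnected_compl.induction₂'
      (fun a b => Relation.ReflTransGen
        (FaceStep {w : Site 2 | Metric.closedBall (meshPoint δ w) (2 * δ) ⊆ D'.carrier})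
        (nearestSite δ a) (nearestSite δ b)) ?_ ?_ ha hb
    · intro a ha
      rw [eventually_nhdsWithin_iff, Metric.eventually_nhds_iff]
      refine ⟨δ, hδ, fun b hb hbS => ⟨?_, ?_⟩⟩
      · refine reflTransGen_faceStep_nearestSite hδ hbS _ ?_
        calc dist (meshPoint δ (nearestSite δ a)) b
            ≤ dist (meshPoint δ (nearestSite δ a)) a + dist a b := dist_triangle _ _ _
          _ ≤ δ + δ := add_le_add (dist_meshPoint_nearestSite_le hδ a)
              (by rw [dist_comm]; exact hb.le)
          _ = 2 * δ := by ring
      · refine reflTransGen_faceStep_nearestSite hδ ha _ ?_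
        calc dist (meshPoint δ (nearestSite δ b)) a
            ≤ dist (meshPoint δ (nearestSite δ b)) b + dist b a := dist_triangle _ _ _
          _ ≤ δ + δ := add_le_add (dist_meshPoint_nearestSite_le hδ b) hb.le
          _ = 2 * δ := by ring
    · intro a b c _ _ _ hab hbc
      exact hab.trans hbc
  exact ⟨nearestSite δ ⟨0, R⟩, hM,
    (reflTransGen_faceStep_nearestSite hδ hqD x hqx).trans (hchain hqD hqfD)⟩

end Summit.CriticalPhenomena.SAWScalingLimit.Theorems.AvoidanceLimit.Anchor
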